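import Literature.GroupTheory.CombinatorialGroupTheory.PuncturedSurfaceGroupFree
import HarnessLib

/-!
# An explicit free basis of the punctured surface group `Γ_{g,r+1}`

Topic `Literature/GroupTheory/CombinatorialGroupTheory`; continues `PuncturedSurfaceGroupFree.lean`,
which records `Γ_{g,r+1} ≅ F((Fin g × Bool) ⊕ Fin r)` only as `Nonempty`.  For the
Reidemeister–Schreier / covering computation of finite-index subgroups of `Γ_{g,r+1}`
(Hoare–Karrass–Solitar; Zieschang–Vogt–Coldewey §4.14) the images of the generators are needed,
so we name the Tietze isomorphism: `PuncturedSurfaceGroup.freeEquiv g r : Γ_{g,r+1} ≃* F(X)`,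
`X = (Fin g × Bool) ⊕ Fin r`, with

* `aᵢ ↦ (i,false)`, `bᵢ ↦ (i,true)` (`freeEquiv_a`, `freeEquiv_b`), `c_{j+2} ↦ inr j`
  (`freeEquiv_c_succ`), and `c₁ ↦ A⁻¹ B⁻¹` (`freeEquiv_c_zero`), where `A = ∏ᵢ [aᵢ, bᵢ]`
  (`commProd`) and `B = ∏ⱼ c_{j+2}` (`cuspProd`) — the single relator `A c₁ B = 1` solved for `c₁`
  ([SemiAnbd] Example 2.10: `Γ_{g,r}` is free of rank `2g + r - 1` for `r ≥ 1`).

Definitions with their defining equations; no new mathematics beyond `PuncturedSurfaceGroupFree`.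

## References

* S. Mochizuki, *Semi-graphs of anabelioids*, Publ. RIMS 42 (2006), Example 2.10. [MochizukiSemiAnbd2006]
* H. Zieschang, E. Vogt, H.-D. Coldewey, *Surfaces and Planar Discontinuous Groups*, LNM 835,
  Springer 1980, 3.1.8, §4.14. [ZieschangVogtColdewey1980]
-/

namespace Literature.GroupTheory.CombinatorialGroupTheory.PuncturedSurfaceGroup

variable (g r : ℕ)

/-- `A = ∏ᵢ [aᵢ, bᵢ]` in the free group on `(Fin g × Bool) ⊕ Fin r`
(`aᵢ = inl (i,false)`, `bᵢ = inl (i,true)`). [cite: MochizukiSemiAnbd2006, Ex. 2.10 p.31] -/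
def commProd : FreeGroup ((Fin g × Bool) ⊕ Fin r) :=
  ((List.finRange g).map fun i =>
    FreeGroup.of (Sum.inl (i, false)) * FreeGroup.of (Sum.inl (i, true)) *
      (FreeGroup.of (Sum.inl (i, false)))⁻¹ * (FreeGroup.of (Sum.inl (i, true)))⁻¹).prod

/-- `B = ∏_{j<r} c_{j+2}` in the free group on `(Fin g × Bool) ⊕ Fin r` (`c_{j+2} = inr j`).
[cite: MochizukiSemiAnbd2006, Ex. 2.10 p.31] -/
def cuspProd : FreeGroup ((Fin g × Bool) ⊕ Fin r) :=
  ((List.finRange r).map fun j => FreeGroup.of (Sum.inr j)).prod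

/-- The images of the generators of `Γ_{g,r+1}` in the free group: `aᵢ, bᵢ ↦` themselves,
`c₁ ↦ A⁻¹ B⁻¹`, `c_{j+2} ↦ inr j`. [cite: MochizukiSemiAnbd2006, Ex. 2.10 p.31] -/
def freeGenImage : puncturedSurfaceGen g (r + 1) → FreeGroup ((Fin g × Bool) ⊕ Fin r)
  | Sum.inl y => FreeGroup.of (Sum.inl y)
  | Sum.inr j => Fin.cases ((commProd g r)⁻¹ * (cuspProd g r)⁻¹) (fun j' => FreeGroup.of (Sum.inr j')) j

/-- `c₁ ↦ A⁻¹ B⁻¹`. [cite: MochizukiSemiAnbd2006, Ex. 2.10 p.31] -/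
@[simp] theorem freeGenImage_inr_zero :
    freeGenImage g r (Sum.inr 0) = (commProd g r)⁻¹ * (cuspProd g r)⁻¹ := by
  simp [freeGenImage]

/-- `c_{j+2} ↦ inr j`. [cite: MochizukiSemiAnbd2006, Ex. 2.10 p.31] -/
@[simp] theorem freeGenImage_inr_succ (j : Fin r) :
    freeGenImage g r (Sum.inr (Fin.succ j)) = FreeGroup.of (Sum.inr j) := by
  simp [freeGenImage]

/-- `aᵢ, bᵢ ↦` the corresponding free generators. [cite: MochizukiSemiAnbd2006, Ex. 2.10 p.31] -/
@[simp] theorem freeGenImage_inl (y : Fin g × Bool) :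
    freeGenImage g r (Sum.inl y) = FreeGroup.of (Sum.inl y) := rfl

/-- The assignment kills the relator `A · c₁ · B`. [cite: MochizukiSemiAnbd2006, Ex. 2.10 p.31] -/
theorem lift_freeGenImage_relator :
    FreeGroup.lift (freeGenImage g r) (relator g (r + 1)) = 1 := by
  have hA : FreeGroup.lift (freeGenImage g r) (((List.finRange g).map fun i =>
      genA (r := r + 1) i * genB (r := r + 1) i * (genA (r := r + 1) i)⁻¹ *
        (genB (r := r + 1) i)⁻¹).prod) = commProd g r := by
    simp only [commProd, map_list_prod, List.map_map, Function.comp_def, map_mul, map_inv, genA, genB,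
      FreeGroup.lift_apply_of, freeGenImage_inl]
  have hB : FreeGroup.lift (freeGenImage g r)
      (((List.finRange r).map fun j => genC (g := g) (Fin.succ j)).prod) = cuspProd g r := by
    simp only [cuspProd, map_list_prod, List.map_map, Function.comp_def, genC, FreeGroup.lift_apply_of,
      freeGenImage_inr_succ]
  rw [relator_succ, map_mul, map_mul, hA, hB, genC, FreeGroup.lift_apply_of, freeGenImage_inr_zero]
  group

/-- `Γ_{g,r+1} → F(X)`, the Tietze elimination of `c₁`. [cite: MochizukiSemiAnbd2006, Ex. 2.10 p.31] -/
def toFree : PuncturedSurfaceGroup g (r + 1) →* FreeGroup ((Fin g × Bool) ⊕ Fin r) :=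
  PresentedGroup.toGroup (f := freeGenImage g r) (by
    intro w hw
    rw [Set.mem_singleton_iff] at hw
    rw [hw]; exact lift_freeGenImage_relator g r)

/-- `toFree` on a generator. [cite: MochizukiSemiAnbd2006, Ex. 2.10 p.31] -/
@[simp] theorem toFree_of (x : puncturedSurfaceGen g (r + 1)) :
    toFree g r (PresentedGroup.of x) = freeGenImage g r x :=
  PresentedGroup.toGroup.of _

/-- `F(X) → Γ_{g,r+1}`: `inl y ↦ inl y`, `inr j ↦ c_{j+2}`. [cite: MochizukiSemiAnbd2006, Ex. 2.10 p.31] -/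
def ofFree : FreeGroup ((Fin g × Bool) ⊕ Fin r) →* PuncturedSurfaceGroup g (r + 1) :=
  FreeGroup.lift fun y =>
    match y with
    | Sum.inl x => PresentedGroup.of (Sum.inl x)
    | Sum.inr j => PresentedGroup.of (Sum.inr (Fin.succ j))

/-- `ofFree` on an `a`/`b` generator. [cite: MochizukiSemiAnbd2006, Ex. 2.10 p.31] -/
@[simp] theorem ofFree_of_inl (x : Fin g × Bool) :
    ofFree g r (FreeGroup.of (Sum.inl x)) = PresentedGroup.of (Sum.inl x) := by
  simp [ofFree]

/-- `ofFree` on a `c` generator. [cite: MochizukiSemiAnbd2006, Ex. 2.10 p.31] -/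
@[simp] theorem ofFree_of_inr (j : Fin r) :
    ofFree g r (FreeGroup.of (Sum.inr j)) = PresentedGroup.of (Sum.inr (Fin.succ j)) := by
  simp [ofFree]

/-- `ofFree A = [∏[aᵢ,bᵢ]]`. [cite: MochizukiSemiAnbd2006, Ex. 2.10 p.31] -/
theorem ofFree_commProd : ofFree g r (commProd g r) =
    PresentedGroup.mk _ (((List.finRange g).map fun i =>
      genA (r := r + 1) i * genB (r := r + 1) i * (genA (r := r + 1) i)⁻¹ * (genB (r := r + 1) i)⁻¹).prod) := by
  simp only [commProd, map_list_prod, List.map_map, Function.comp_def, map_mul, map_inv, ofFree_of_inl,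
    genA, genB]
  rfl

/-- `ofFree B = [c₂ ⋯ c_{r+1}]`. [cite: MochizukiSemiAnbd2006, Ex. 2.10 p.31] -/
theorem ofFree_cuspProd : ofFree g r (cuspProd g r) =
    PresentedGroup.mk _ (((List.finRange r).map fun j => genC (g := g) (Fin.succ j)).prod) := by
  simp only [cuspProd, map_list_prod, List.map_map, Function.comp_def, ofFree_of_inr, genC]
  rfl

/-- The relation `c₁ = A⁻¹ B⁻¹` in `Γ_{g,r+1}`. [cite: MochizukiSemiAnbd2006, Ex. 2.10 p.31] -/
theorem c_zero_eq : (c 0 : PuncturedSurfaceGroup g (r + 1)) =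
    (ofFree g r (commProd g r))⁻¹ * (ofFree g r (cuspProd g r))⁻¹ := by
  have h1 := PresentedGroup.one_of_mem (rels := ({relator g (r + 1)} : Set _))
    (Set.mem_singleton (relator g (r + 1)))
  have h1' : PresentedGroup.mk ({relator g (r + 1)} : Set _)
      ((((List.finRange g).map fun i => genA (r := r + 1) i * genB (r := r + 1) i *
        (genA (r := r + 1) i)⁻¹ * (genB (r := r + 1) i)⁻¹).prod) *
        (genC (g := g) 0 * ((List.finRange r).map fun j => genC (g := g) (Fin.succ j)).prod)) = 1 := by
    rw [← relator_succ]; exact h1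
  rw [map_mul, map_mul, ← ofFree_commProd, ← ofFree_cuspProd] at h1'
  exact eq_mul_inv_of_mul_eq (eq_inv_of_mul_eq_one_right h1')

/-- `ofFree ∘ toFree = id`. [cite: MochizukiSemiAnbd2006, Ex. 2.10 p.31] -/
theorem ofFree_comp_toFree : (ofFree g r).comp (toFree g r) = MonoidHom.id _ := by
  apply PresentedGroup.ext
  intro x
  rw [MonoidHom.comp_apply, MonoidHom.id_apply, toFree_of]
  rcases x with y | j
  · simp
  · refine Fin.cases ?_ (fun j' => ?_) j
    · rw [freeGenImage_inr_zero, map_mul, map_inv, map_inv, ← c_zero_eq]; rfl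
    · simp

/-- `toFree ∘ ofFree = id`. [cite: MochizukiSemiAnbd2006, Ex. 2.10 p.31] -/
theorem toFree_comp_ofFree : (toFree g r).comp (ofFree g r) = MonoidHom.id _ := by
  apply FreeGroup.ext_hom
  intro y
  rw [MonoidHom.comp_apply, MonoidHom.id_apply]
  rcases y with x | j
  · rw [ofFree_of_inl, toFree_of, freeGenImage_inl]
  · rw [ofFree_of_inr, toFree_of, freeGenImage_inr_succ]

/-- **The free basis of `Γ_{g,r+1}`**: the isomorphism `Γ_{g,r+1} ≃* F((Fin g × Bool) ⊕ Fin r)`,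
`aᵢ, bᵢ ↦ aᵢ, bᵢ`, `c_{j+2} ↦ inr j`, `c₁ ↦ A⁻¹B⁻¹` ([SemiAnbd] Ex. 2.10: `Γ_{g,r}` is free of rank
`2g + r - 1` for `r ≥ 1`). [cite: MochizukiSemiAnbd2006, Ex. 2.10 p.31] -/
def freeEquiv : PuncturedSurfaceGroup g (r + 1) ≃* FreeGroup ((Fin g × Bool) ⊕ Fin r) :=
  MonoidHom.toMulEquiv (toFree g r) (ofFree g r) (ofFree_comp_toFree g r) (toFree_comp_ofFree g r)

variable {g r}

/-- `freeEquiv aᵢ = (i,false)`. [cite: MochizukiSemiAnbd2006, Ex. 2.10 p.31] -/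
@[simp] theorem freeEquiv_a (i : Fin g) :
    freeEquiv g r (a i) = FreeGroup.of (Sum.inl (i, false)) := by
  rw [freeEquiv, MonoidHom.toMulEquiv_apply]; exact toFree_of g r (Sum.inl (i, false))

/-- `freeEquiv bᵢ = (i,true)`. [cite: MochizukiSemiAnbd2006, Ex. 2.10 p.31] -/
@[simp] theorem freeEquiv_b (i : Fin g) :
    freeEquiv g r (b i) = FreeGroup.of (Sum.inl (i, true)) := by
  rw [freeEquiv, MonoidHom.toMulEquiv_apply]; exact toFree_of g r (Sum.inl (i, true))

/-- `freeEquiv` on the class of an `a`/`b` generator. [cite: MochizukiSemiAnbd2006, Ex. 2.10 p.31] -/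
@[simp] theorem freeEquiv_of_inl (y : Fin g × Bool) :
    freeEquiv g r (PresentedGroup.of (Sum.inl y)) = FreeGroup.of (Sum.inl y) := by
  rw [freeEquiv, MonoidHom.toMulEquiv_apply]; exact toFree_of g r (Sum.inl y)

/-- `freeEquiv c_{j+2} = inr j`. [cite: MochizukiSemiAnbd2006, Ex. 2.10 p.31] -/
@[simp] theorem freeEquiv_c_succ (j : Fin r) :
    freeEquiv g r (c (Fin.succ j)) = FreeGroup.of (Sum.inr j) := by
  rw [freeEquiv, MonoidHom.toMulEquiv_apply]
  exact (toFree_of g r (Sum.inr (Fin.succ j))).trans (freeGenImage_inr_succ g r j)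

/-- `freeEquiv c₁ = A⁻¹ B⁻¹`. [cite: MochizukiSemiAnbd2006, Ex. 2.10 p.31] -/
theorem freeEquiv_c_zero :
    freeEquiv g r (c 0) = (commProd g r)⁻¹ * (cuspProd g r)⁻¹ := by
  rw [freeEquiv, MonoidHom.toMulEquiv_apply]
  exact (toFree_of g r (Sum.inr 0)).trans (freeGenImage_inr_zero g r)

/-- `freeEquiv⁻¹ (inl y) = [y]`. [cite: MochizukiSemiAnbd2006, Ex. 2.10 p.31] -/
@[simp] theorem freeEquiv_symm_of_inl (y : Fin g × Bool) :
    (freeEquiv g r).symm (FreeGroup.of (Sum.inl y)) = PresentedGroup.of (Sum.inl y) := by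
  rw [freeEquiv, MonoidHom.toMulEquiv_symm_apply]; exact ofFree_of_inl g r y

/-- `freeEquiv⁻¹ (inr j) = c_{j+2}`. [cite: MochizukiSemiAnbd2006, Ex. 2.10 p.31] -/
@[simp] theorem freeEquiv_symm_of_inr (j : Fin r) :
    (freeEquiv g r).symm (FreeGroup.of (Sum.inr j)) = c (Fin.succ j) := by
  rw [freeEquiv, MonoidHom.toMulEquiv_symm_apply]; exact ofFree_of_inr g r j

end Literature.GroupTheory.CombinatorialGroupTheory.PuncturedSurfaceGroup
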